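import Summits.BirchSwinnertonDyer.BirchSwinnertonDyer.Theorems.KolyvaginRoadThreeMethod2TransLocal
import Summits.BirchSwinnertonDyer.BirchSwinnertonDyer.Theorems.KolyvaginRoadThreeMethod2Iso
import Literature.NumberTheory.EllipticCurves.SelmerFiniteProofs
import Literature.NumberTheory.GaloisRepresentations.FrobeniusGeneration
import HarnessLib

/-!
# Method 2 at `p = 3` — (Trans): `H¹_fin ∩ H¹_ord = 0` at a good unipotent-admissible prime; stub A from (Cheb) + (Equiv)

Sub-problem `BirchSwinnertonDyer`, route `KolyvaginRoadThree`, METHOD line (koly v2x) on the crux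
`ZhangSharpFrameAtThreeHL` (`stmt-BirchSwinnertonDyer-19574`).  koly3a reduced the registered stub A
(`stub_levelRaisingAtThree`, rank lowering at one new good unipotent-admissible prime) to five local–global
inputs (`selQ_rankLowering_on_of_localGlobal`, file `KolyvaginRoadThreeMethod2RankLoweringGood`): (Cheb),
(Equiv), (Line), (Trans), (Iso).  (Line) and (Iso) are the tree's `hline` / `hiso`
(`KolyvaginRoadThreeMethod2Iso`).  This file discharges (Trans) UNCONDITIONALLY and records the composition:
stub A now follows from (Cheb) and (Equiv) alone.

* `torsionLocMap_eq_zero_of_mem_selmerLocalKer_of_mem_ordinaryLocalKer` — at the place `v ∣ q` of a good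
  unipotent-admissible prime, a class of `H¹(K, E[3])` that is both Kummer (`selmerLocalKer`, image of
  `E(K_v)/3`) and ordinary (`ordinaryLocalKer`, restriction in the image of `H¹(K_v, E[3]^{Γ_v})`) has ZERO
  localisation in `H¹(K_v, E[3])`.  Proof (Gross 1991 §4 / Zhang 2014 §5 in cocycle form): a cocycle `φ` of the
  class is unramified at `𝔓 ∣ v` (Kummer classes at a good `v ∤ 3` are unramified, Silverman X.4.4 — the tree's
  `selmerLocalKerOfEmb_le_unramifiedKer_primeBelow` with the discharged facts `exists_mem_inertia_apply_eq_holds`,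
  `smul_localPoints_eq_of_mem_inertia_holds` — and inertia acts trivially on `E[3]`, VII.4.1), and on the
  decomposition group `G_𝔓 = res Γ_{K_v}` (Neukirch II (9.6), both inclusions in the tree) it is, up to the
  coboundary of some `m`, valued in the fixed line `L₀ = E[3]^{G_𝔓}` (ordinarity,
  `exists_invariant_cocycle_of_mem_ordinaryLocalKer`).  Its value at the Frobenius `F` of
  `exists_frobenius_unipotent` is `F`-fixed, hence `= F m₃ − m₃` (`ker (F−1) = im (F−1)`); the cocycle identity
  then gives `φ(Fᵏ) = Fᵏ M − M` (`M = m₃ − m`), and since `G_𝔓` is generated by `F`, `I_𝔓` and any open subgroup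
  (Neukirch I (9.4), `exists_eq_frobenius_pow_mul_of_mem_decompositionSubgroup`, applied with the open subgroup
  of `Γ_{K(E[3])}` on which `φ` vanishes), `φ(d) = d M − M` on all of `G_𝔓`: the local class is a coboundary.
* `htrans` — (Trans) in koly3a's binder shape (first reducing to the Kummer case: `z − a y` has zero
  localisation, so lies in `torsionLocalKer ≤ selmerLocalKer`).
* `stub_levelRaisingAtThree_of_cheb_equiv` — the registered v2x text of stub A from the frame-wise conjunction
  of (Cheb) and (Equiv) only (koly3a's theorem fed with `hline`, `htrans`, `hiso`).

What remains for stub A: (Cheb) — a Čebotarev class in `K(E[3], witnesses)/ℚ` (MEMO-v8 §4, the `GL₂(𝔽₃)`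
computation over `GL2F3.M2`) — and (Equiv) — the sign of complex conjugation on the localisation line at the
inert place (`IsLiftOfAut.h1Eval_conjAct`).
-/

noncomputable section

open scoped Classical Pointwise

namespace Summit.BirchSwinnertonDyer.Rank1Residual.X11b.Three.Koly.Method2.Iso

open WeierstrassCurve Field Function NumberField IsDedekindDomain Rat.HeightOneSpectrum
open Literature.NumberTheory.EllipticCurves Literature.NumberTheory.EllipticCurves.ModularForms
  Literature.NumberTheory.GaloisRepresentations Module
open Summit.BirchSwinnertonDyer.Rank1Residual.X11b.Three.Koly.Method2

section Trans

variable (W : WeierstrassCurve ℚ) (K : Type) [Field K] [NumberField K] [W.IsElliptic] [W.IsGloballyMinimal]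

omit [W.IsGloballyMinimal] in
/-- A prime not dividing the conductor is a prime of good reduction (private copy of the tree's
`hasGoodReductionAtPrime_of_not_dvd_conductorNorm`, file `HidaFamilyMembersProofs`, whose imports are not wanted here).
[cite: Silverman1994, IV.10.2(a)] -/
private theorem hasGoodReductionAtPrime_of_not_dvd_conductorNorm'' {ℓ : ℕ} [hℓ : Fact ℓ.Prime]
    (h : ¬ ℓ ∣ W.conductorNorm ℤ) : W.HasGoodReductionAtPrime ℓ := by
  set v : HeightOneSpectrum ℤ := (Rat.HeightOneSpectrum.primesEquiv (R := ℤ)).symm ⟨ℓ, hℓ.out⟩ with hv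
  have hgen : Rat.HeightOneSpectrum.natGenerator v = ℓ :=
    congrArg Subtype.val ((Rat.HeightOneSpectrum.primesEquiv (R := ℤ)).apply_symm_apply ⟨ℓ, hℓ.out⟩)
  have hfac : (W.conductorNorm ℤ).factorization ℓ = 0 := Nat.factorization_eq_zero_of_not_dvd h
  have hf : W.conductorExponent v = 0 := by
    rw [← W.factorization_conductorNorm_holds v, hgen, hfac]
  have hgood' : W.HasGoodReductionAt v := (WeierstrassCurve.conductorExponent_eq_zero_iff_holds v W).mp hf
  exact (W.hasGoodReductionAtPrime_iff_hasGoodReductionAt_holds ⟨ℓ, hℓ.out⟩).mpr hgood'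

/-- **(Trans), core: `H¹_fin(K_v, E[3]) ∩ H¹_ord(K_v, E[3]) = 0` at a good unipotent-admissible prime.**
Let `K` be imaginary quadratic, `q` a unipotent-admissible prime of `E = W/ℚ` with `Frob_q² ≠ 1` on `E[3]`
(`FrobSqNeOneAt W 3 q`) and `v ∋ q` the place of `K`.  If `z ∈ H¹(K, E[3])` satisfies the Kummer condition
at `v` (`z ∈ selmerLocalKer`, i.e. `z_v ∈ im (E(K_v)/3)`) and the ordinary condition at `v`
(`z ∈ ordinaryLocalKer`, i.e. `res_v z ∈ im H¹(K_v, E[3]^{Γ_v})`), then `z_v = 0` in `H¹(K_v, E[3])`.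
Gross 1991 §4 eq. (4.3)–(4.6) / Zhang 2014 Lemma 5.1: at such `q`, `H¹_fin = E[3]/(Frob − 1)` and
`H¹_ord = Hom(Γ_v/I_v, E[3]^{Frob})` meet trivially because `Frob_v` is a non-trivial unipotent
(`exists_frobenius_unipotent`).  Proof in cocycle form, see the module docstring.
[cite: GrossLMS1991, §4 (4.3)–(4.6)] [cite: Zhang2014, §5 Lemma 5.1] -/
theorem torsionLocMap_eq_zero_of_mem_selmerLocalKer_of_mem_ordinaryLocalKer (hK : IsImaginaryQuadratic K)
    (q : {q // IsUAdmissiblePrime W K q}) (hq : FrobSqNeOneAt W 3 q.1) (v : HeightOneSpectrum (𝓞 K))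
    (hv : ((q : ℕ) : 𝓞 K) ∈ v.asIdeal) {z : galH1Torsion (W.baseChange K) ((3 ^ 1 : ℕ) : ℤ)}
    (hzK : z ∈ selmerLocalKer (W.baseChange K) (v.adicCompletion K) ((3 ^ 1 : ℕ) : ℤ))
    (hzO : z ∈ (W.baseChange K).ordinaryLocalKer (v.adicCompletion K) ((3 ^ 1 : ℕ) : ℤ)) :
    (W.baseChange K).torsionLocMap (v.adicCompletion K) ((3 ^ 1 : ℕ) : ℤ) z = 0 := by
  haveI : CharZero (v.adicCompletion K) := charZero_adicCompletion v
  have hqp : (q : ℕ).Prime := q.2.1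
  haveI : Fact (q : ℕ).Prime := ⟨hqp⟩
  have hq3 : (q : ℕ) ≠ 3 := q.2.2.2.2.1
  -- ### data at `v`: the chosen embedding, a prime `𝔓 ∣ v`, the Frobenius package
  obtain ⟨𝔐, h𝔐⟩ := v.localPrimesAbove_nonempty
  set ι₀ := closureEmb (K := K) (v.adicCompletion K) with hι₀
  set 𝔓 := v.primeBelow ι₀ 𝔐 with h𝔓def
  have h𝔓 : 𝔓 ∈ v.primesAbove := HeightOneSpectrum.primeBelow_mem_primesAbove h𝔐
  haveI : 𝔓.IsPrime := h𝔓.1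
  obtain ⟨F, hF, -, hkerim⟩ := exists_frobenius_unipotent W K hK q hq v hv h𝔐
  have hF𝔓 : F ∈ 𝔓.decompositionSubgroup (absoluteGaloisGroup K) := hF.mem_stabilizer
  -- ### good reduction at `v` and `v ∤ 3`
  set v₁ : HeightOneSpectrum (𝓞 ℚ) := v.under (𝓞 ℚ) with hv₁
  have hqv₁ : ((q : ℕ) : 𝓞 ℚ) ∈ v₁.asIdeal := by
    rw [show v₁.asIdeal = v.asIdeal.under (𝓞 ℚ) from rfl, Ideal.under_def, Ideal.mem_comap, map_natCast]
    exact hv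
  have hgood : W.HasGoodReductionAtPrime q := hasGoodReductionAtPrime_of_not_dvd_conductorNorm'' W q.2.2.1
  have hgood₁ : W.HasGoodReductionAt v₁ :=
    (hasGoodReductionAtPrime_primesEquiv_iff_holds W v₁ q (primesEquiv_eq_of_natCast_mem hqp hqv₁)).mp hgood
  haveI : v.asIdeal.LiesOver v₁.asIdeal := ⟨rfl⟩
  have hgoodK : (W.baseChange K).HasGoodReductionAt v :=
    hasGoodReductionAt_baseChange_of_hasGoodReductionAt_rat W v₁ v hgood₁
  have hvbad : v ∉ (W.baseChange K).badPlaces (𝓞 K) := fun h ↦ h hgoodK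
  have h3v : ((((3 ^ 1 : ℕ) : ℤ)) : 𝓞 K) ∉ v.asIdeal := by
    intro h3
    have hcop : Nat.Coprime (q : ℕ) 3 := (Nat.coprime_primes hqp Nat.prime_three).mpr hq3
    obtain ⟨a, b, hab⟩ := (Nat.isCoprime_iff_coprime.mpr hcop : IsCoprime ((q : ℕ) : ℤ) (3 : ℤ))
    apply v.isPrime.ne_top
    rw [Ideal.eq_top_iff_one]
    have h1 : (1 : 𝓞 K) = (a : 𝓞 K) * ((q : ℕ) : 𝓞 K) + (b : 𝓞 K) * ((((3 ^ 1 : ℕ) : ℤ)) : 𝓞 K) := by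
      rw [pow_one]
      exact_mod_cast congrArg (fun t : ℤ => (t : 𝓞 K)) hab.symm
    rw [h1]
    exact v.asIdeal.add_mem (v.asIdeal.mul_mem_left _ hv) (v.asIdeal.mul_mem_left _ h3)
  -- ### inertia acts trivially on `E[3](K̄)`; the Kummer class `z` is unramified at `𝔓`
  have hI : 𝔓.inertia (absoluteGaloisGroup K) ≤ torsionFixing (W.baseChange K) ((3 ^ 1 : ℕ) : ℤ) :=
    inertia_le_torsionFixing (W.baseChange K) hvbad h3v ι₀ h𝔐
  have hunr : z ∈ unramifiedKer (geomTorsion (W.baseChange K) ((3 ^ 1 : ℕ) : ℤ)) 𝔓 :=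
    (W.baseChange K).selmerLocalKerOfEmb_le_unramifiedKer_primeBelow v.exists_mem_inertia_apply_eq_holds
      (W.baseChange K).smul_localPoints_eq_of_mem_inertia_holds hvbad h3v ι₀ h𝔐 hzK
  -- ### the cocycle of `z`
  set φ := reprCocycle (W.baseChange K) ((3 ^ 1 : ℕ) : ℤ) z with hφdef
  have hclass : oneCocycleClass _ φ = z := oneCocycleClass_reprCocycle (W.baseChange K) _ z
  have hcoc : ∀ a b : absoluteGaloisGroup K, φ.1 (a * b) = φ.1 a + a • φ.1 b := fun a b ↦ by
    have := φ.2 a b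
    rw [discreteTopRep_ρ_apply] at this
    exact this
  have hφI : ∀ i ∈ 𝔓.inertia (absoluteGaloisGroup K), φ.1 i = 0 := by
    have hx' : oneCocycleClass _ φ ∈ unramifiedKer (geomTorsion (W.baseChange K) ((3 ^ 1 : ℕ) : ℤ)) 𝔓 := by
      rwa [hclass]
    obtain ⟨a, ha⟩ := (oneCocycleClass_mem_subgroupResKer_iff _ φ).mp hx'
    intro i hi
    rw [ha ⟨i, hi⟩, Subgroup.coe_mk, smul_eq_of_mem_torsionFixing (W.baseChange K) _ (hI hi), sub_self]
  -- ### ordinary: on `res(Γ_{K_v})`, `φ` is an invariant-valued cocycle up to the coboundary of `m`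
  obtain ⟨ψ, hψinv, hψ⟩ :=
    exists_invariant_cocycle_of_mem_ordinaryLocalKer (W.baseChange K) (3 ^ 1) (v.adicCompletion K) hzO
  rw [← hclass, res_torsionGaloisModule_oneCocycleClass, ← sub_eq_zero, ← oneCocycleClass_sub,
    oneCocycleClass_eq_zero_iff] at hψ
  obtain ⟨m, hm⟩ := hψ
  have hm' : ∀ g : absoluteGaloisGroup (v.adicCompletion K),
      φ.1 (resGal (K := K) (v.adicCompletion K) g) =
        ψ.1 g - (resGal (K := K) (v.adicCompletion K) g • m - m) := fun g ↦ by
    have h1 : ψ.1 g - φ.1 (absGaloisRestrict K (v.adicCompletion K) g) =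
        absGaloisRestrict K (v.adicCompletion K) g • m - m := hm g
    rw [← resGal_eq_absGaloisRestrict] at h1
    rw [← h1]
    abel
  -- ### local–global: the decomposition group is the image of `Γ_{K_v}`
  have hGP : ∀ d ∈ 𝔓.decompositionSubgroup (absoluteGaloisGroup K),
      ∃ σ : absoluteGaloisGroup (v.adicCompletion K), resGal (K := K) (v.adicCompletion K) σ = d := fun d hd ↦ by
    obtain ⟨σ, hσ⟩ := exists_apply_eq_smul_of_mem_decompositionSubgroup ι₀ h𝔐 hd
    exact ⟨σ, by rw [resGal_eq]; exact resGalOfEmb_eq_of_apply_eq ι₀ hσ⟩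
  -- ### `φ F + (F m - m)` is `F`-fixed, hence in the image of `F - 1`
  obtain ⟨σF, hσF⟩ := hGP F hF𝔓
  have hfix : F • (φ.1 F + (F • m - m)) = φ.1 F + (F • m - m) := by
    rw [← hσF, hm' σF, sub_add_cancel, resGal_eq_absGaloisRestrict]
    exact hψinv σF σF
  obtain ⟨m₃, hm₃⟩ := hkerim _ hfix
  -- ### the cocycle is the coboundary of `m + m₃` on the whole decomposition group
  have hU := isOpen_evalKer (W.baseChange K) ((3 ^ 1 : ℕ) : ℤ) (fun _ : Unit ↦ z)
    (isOpen_torsionFixing (W.baseChange K) (n := ((3 ^ 1 : ℕ) : ℤ)) (by norm_num))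
  have hφF : φ.1 F = F • (m₃ - m) - (m₃ - m) := by
    have h1 : φ.1 F = (F • m₃ - m₃) - (F • m - m) := by rw [hm₃, add_sub_cancel_right]
    rw [h1, smul_sub]
    abel
  have hpow : ∀ k : ℕ, φ.1 (F ^ k) = F ^ k • (m₃ - m) - (m₃ - m) := by
    intro k
    induction k with
    | zero => rw [pow_zero, one_smul, sub_self]; exact contOneCocycles.apply_one φ
    | succ k ih =>
      rw [pow_succ F k, hcoc, ih, hφF, mul_smul]
      simp only [smul_sub]
      abel
  have key : ∀ d ∈ 𝔓.decompositionSubgroup (absoluteGaloisGroup K), φ.1 d = d • (m₃ - m) - (m₃ - m) := by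
    intro d hd
    obtain ⟨k, i, u, hi, hu, hdec⟩ := exists_eq_frobenius_pow_mul_of_mem_decompositionSubgroup h𝔓 hF hU hd
    have hufix : u ∈ torsionFixing (W.baseChange K) ((3 ^ 1 : ℕ) : ℤ) := hu.1
    have hφu : φ.1 u = 0 := hu.2 ()
    have hifix : i ∈ torsionFixing (W.baseChange K) ((3 ^ 1 : ℕ) : ℤ) := hI hi
    rw [hdec, hcoc, hcoc, hpow, hφI i hi, hφu, smul_zero, add_zero, smul_zero, add_zero, mul_smul, mul_smul,
      smul_eq_of_mem_torsionFixing (W.baseChange K) _ hufix, smul_eq_of_mem_torsionFixing (W.baseChange K) _ hifix]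
  -- ### conclusion: the local class of `z` is the coboundary of `θ(m + m₃)`
  have hker : z ∈ (W.baseChange K).torsionLocalKer (v.adicCompletion K) ((3 ^ 1 : ℕ) : ℤ) := by
    rw [← hclass]
    refine (oneCocycleClass_mem_resKer_iff _ _ _ φ).mpr
      ⟨torsionPointsMap (W.baseChange K) (v.adicCompletion K) _ (m₃ - m), fun g ↦ ?_⟩
    have hd : resGal (K := K) (v.adicCompletion K) g ∈ 𝔓.decompositionSubgroup (absoluteGaloisGroup K) := by
      rw [resGal_eq]; exact resGalOfEmb_mem_decompositionSubgroup ι₀ h𝔐 g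
    rw [key _ hd, map_sub, torsionPointsMap_smul]
  exact hker


/-- **(Trans) — the transversality input of koly3a's `selQ_rankLowering_on_of_localGlobal`, discharged.**
For `K` imaginary quadratic: at the place `v ∋ q` of a good unipotent-admissible prime `q` with
`Frob_q² ≠ 1` on `E[3]`, if `y` is a Kummer class at `v`, `z` an ordinary class at `v`, and the localisation
of `z` is an integer multiple of that of `y`, then the localisation of `z` vanishes.  (Reduce to
`torsionLocMap_eq_zero_of_mem_selmerLocalKer_of_mem_ordinaryLocalKer`: `z − a y` has zero localisation, so
`z ∈ selmerLocalKer`.) [cite: GrossLMS1991, §4 (4.3)–(4.6)] [cite: Zhang2014, §5 Lemma 5.1] -/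
theorem htrans (hK : IsImaginaryQuadratic K) :
    ∀ (q : {q // IsUAdmissiblePrime W K q}) (v : HeightOneSpectrum (𝓞 K)), FrobSqNeOneAt W 3 q.1 →
      ((q : ℕ) : 𝓞 K) ∈ v.asIdeal →
      ∀ y z : V3 W K, y ∈ selmerLocalKer (W.baseChange K) (v.adicCompletion K) ((3 ^ 1 : ℕ) : ℤ) →
        z ∈ (W.baseChange K).ordinaryLocalKer (v.adicCompletion K) ((3 ^ 1 : ℕ) : ℤ) →
        (∃ a : ℤ, (W.baseChange K).torsionLocMap (v.adicCompletion K) ((3 ^ 1 : ℕ) : ℤ) z =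
          a • (W.baseChange K).torsionLocMap (v.adicCompletion K) ((3 ^ 1 : ℕ) : ℤ) y) →
        (W.baseChange K).torsionLocMap (v.adicCompletion K) ((3 ^ 1 : ℕ) : ℤ) z = 0 := by
  intro q v hq hv y z hy hz hyz
  obtain ⟨a, ha⟩ := hyz
  -- `z - a • y` has zero localisation, so `z` itself satisfies the Kummer condition at `v`
  have hx : z - a • y ∈ (W.baseChange K).torsionLocalKer (v.adicCompletion K) ((3 ^ 1 : ℕ) : ℤ) := by
    change (W.baseChange K).torsionLocMap (v.adicCompletion K) ((3 ^ 1 : ℕ) : ℤ) (z - a • y) = 0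
    rw [map_sub, map_zsmul, ha, sub_self]
  have hzK : z ∈ selmerLocalKer (W.baseChange K) (v.adicCompletion K) ((3 ^ 1 : ℕ) : ℤ) := by
    have h1 : z = (z - a • y) + a • y := by abel
    rw [h1]
    exact AddSubgroup.add_mem _
      ((W.baseChange K).torsionLocalKer_le_selmerLocalKer (v.adicCompletion K) _ hx)
      (AddSubgroup.zsmul_mem _ hy a)
  exact torsionLocMap_eq_zero_of_mem_selmerLocalKer_of_mem_ordinaryLocalKer W K hK q hq v hv hzK hz

/-- **Stub A of the koly v2x skeleton from (Cheb) and (Equiv) alone.**  The registered text of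
`stub_levelRaisingAtThree` (rank lowering of `Sel_{Q·3}^{±}` at one new good unipotent-admissible prime, on
good levels) follows from the frame-wise conjunction of koly3a's two remaining inputs: (Cheb) — for every
non-zero `x` of a good-level relaxed Selmer group there is a new unipotent-admissible `q ∉ n` with
`Frob_q² ≠ 1` on `E[3]` and `x_v ≠ 0` at the place `v ∣ q` — and (Equiv) — complex conjugation acts on the
localisations at `v ∣ q` by a sign.  The other three inputs are the tree's theorems `hline`, `htrans`, `hiso`.
[cite: Zhang2014, §5 Prop. 5.4, Lemma 5.7] [cite: GrossLMS1991, Prop. 8.2, §9] -/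
theorem stub_levelRaisingAtThree_of_cheb_equiv
    (hLH : ∀ (W : WeierstrassCurve ℚ) [W.IsElliptic] [W.IsGloballyMinimal] [NeZero (W.conductorNorm ℤ)] (K : Type)
      [Field K] [NumberField K] (Dt : ModularParametrizationData W (W.conductorNorm ℤ)) (β : ℤ) (ι : K →+* ℂ),
      Summit.BirchSwinnertonDyer.Rank1Residual.ClassX11b W 3 → W.HasMultiplicativeReductionAtPrime 3 →
      Literature.NumberTheory.EllipticCurves.Rank1Residual.Surj W 3 →
      Literature.NumberTheory.EllipticCurves.Rank1Residual.Ram W 3 → ¬ 3 ∣ W.tamagawaProduct →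
      IsImaginaryQuadratic K → Odd (NumberField.discr K) → SatisfiesHeegnerHypothesis (W.conductorNorm ℤ) K →
      (W.quadraticTwist (NumberField.discr K : ℚ)).entireLFunction 1 ≠ 0 → NumberField.discr K ≠ -3 →
      (4 * (W.conductorNorm ℤ : ℤ)) ∣ β ^ 2 - NumberField.discr K → ¬ (3 : ℤ) ∣ Dt.c →
      ∀ (c : K ≃ₐ[ℚ] K), c ≠ 1 → ∀ [Module (ZMod 3) (V3 W K)],
      -- (Cheb)
      (∀ (n : Finset {q // IsUAdmissiblePrime W K q}) (μ : Bool) (x : V3 W K), GoodLevel W K n →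
        x ∈ SelQ W K c n μ → x ≠ 0 →
        ∃ q : {q // IsUAdmissiblePrime W K q}, q ∉ n ∧ FrobSqNeOneAt W 3 q.1 ∧ ∃ v : HeightOneSpectrum (𝓞 K),
          ((q : ℕ) : 𝓞 K) ∈ v.asIdeal ∧
            (W.baseChange K).torsionLocMap (v.adicCompletion K) ((3 ^ 1 : ℕ) : ℤ) x ≠ 0) ∧
      -- (Equiv)
      (∀ q : {q // IsUAdmissiblePrime W K q}, FrobSqNeOneAt W 3 q.1 → ∃ s : Bool,
        ∀ v : HeightOneSpectrum (𝓞 K), ((q : ℕ) : 𝓞 K) ∈ v.asIdeal → ∀ z : V3 W K,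
          (W.baseChange K).torsionLocMap (v.adicCompletion K) ((3 ^ 1 : ℕ) : ℤ) (conjAct W c ((3 ^ 1 : ℕ) : ℤ) z) =
            sgn s • (W.baseChange K).torsionLocMap (v.adicCompletion K) ((3 ^ 1 : ℕ) : ℤ) z)) :
    ∀ (W : WeierstrassCurve ℚ) [W.IsElliptic] [W.IsGloballyMinimal] [NeZero (W.conductorNorm ℤ)] (K : Type)
      [Field K] [NumberField K] (Dt : ModularParametrizationData W (W.conductorNorm ℤ)) (β : ℤ) (ι : K →+* ℂ),
      Summit.BirchSwinnertonDyer.Rank1Residual.ClassX11b W 3 → W.HasMultiplicativeReductionAtPrime 3 →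
      Literature.NumberTheory.EllipticCurves.Rank1Residual.Surj W 3 →
      Literature.NumberTheory.EllipticCurves.Rank1Residual.Ram W 3 → ¬ 3 ∣ W.tamagawaProduct →
      IsImaginaryQuadratic K → Odd (NumberField.discr K) → SatisfiesHeegnerHypothesis (W.conductorNorm ℤ) K →
      (W.quadraticTwist (NumberField.discr K : ℚ)).entireLFunction 1 ≠ 0 → NumberField.discr K ≠ -3 →
      (4 * (W.conductorNorm ℤ : ℤ)) ∣ β ^ 2 - NumberField.discr K → ¬ (3 : ℤ) ∣ Dt.c →
      ∀ (c : K ≃ₐ[ℚ] K), c ≠ 1 → ∀ [Module (ZMod 3) (V3 W K)],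
      -- (A1) rank lowering at one new GOOD (non-scalar) unipotent-admissible prime, on good levels, (9.1)–(9.2)
      (∀ (n : Finset {q // IsUAdmissiblePrime W K q}) (μ : Bool) (x : V3 W K),
        GoodLevel W K n → x ∈ SelQ W K c n μ → x ≠ 0 →
        ∃ q : {q // IsUAdmissiblePrime W K q}, q ∉ n ∧ GoodLevel W K (insert q n) ∧
          x ∉ SelQ W K c (insert q n) μ ∧
          SelQ W K c (insert q n) μ ≤ SelQ W K c n μ ∧
          finrank (ZMod 3) (SelQ W K c (insert q n) μ) + 1 = finrank (ZMod 3) (SelQ W K c n μ) ∧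
          SelQ W K c (insert q n) (!μ) = SelQ W K c n (!μ)) := by
  intro W _ _ _ K _ _ Dt β ι hX hmult hsurj hram htam hK hodd hH hLt h3 hβ hc c hc1 _
  obtain ⟨hcheb, hequiv⟩ := hLH W K Dt β ι hX hmult hsurj hram htam hK hodd hH hLt h3 hβ hc c hc1
  exact selQ_rankLowering_on_of_localGlobal W K c hcheb hequiv (hline W K hK) (htrans W K hK) (hiso W K c hK)

end Trans

end Summit.BirchSwinnertonDyer.Rank1Residual.X11b.Three.Koly.Method2.Iso

end
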